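import Literature.NumberTheory.ModularSymbols.CuspidalHomologyNormImageEigensystems
import Literature.NumberTheory.ModularSymbols.PeriodHomologyGroupPresentation
import Literature.NumberTheory.EllipticCurves.Gamma0CocycleDegeneracyMaps
import Mathlib.LinearAlgebra.Matrix.GeneralLinearGroup.FinTwo
import Mathlib.GroupTheory.Abelianization.Defs
import HarnessLib

/-!
# The Hilbert-90 defect of the triple cover `X₀(N) → X₀(N/3)` is spanned by fixed-point symbols:
# `Λ_P ⊆ (t − 1)Λ + ℤ{ {∞, γ∞} : γ = (a b; c d) ∈ Γ₀(N), |3(a + d) − c| ≤ 6 }` (`9 ∣ N`)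

Topic `Literature/NumberTheory/ModularSymbols`, sequel to `CuspidalHomologyShiftNorm` (the shift
`t = [1, 1/3; 0, 1]` on `Λ = H₁(X₀(N), ℤ) = periodHomologyHecke N`, `Nm = 1 + t + t²`, the Prym lattice
`Λ_P = prymLattice = ker Nm`, `Λ₁ = shiftSubOneLattice = (t − 1)Λ`), `CuspidalHomologyNormDegeneracy` /
`CuspidalHomologyNormImageEigensystems` (`π_* = pushforwardInt : Λ_N → Λ_{N/3}`, `ker π_* = Λ_P`) and
`PeriodHomologyGroupPresentation` (Knapp's `Γ_ep` and the named fact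
`periodFunctional_ker_le_ellipticParabolic_sup_commutator`: zero periods only on `Γ_ep·[Γ₀, Γ₀]`).
Requested by the BSD ideation cell `bsd-idea-3`, route `TameQuarticManinParity`, LINE 32: this file PROVES the
item E32a `PrymLatticeFixedPointSpan` (stmt-BirchSwinnertonDyer-23756) — input 1 of 2 of the kernel-checked glue
`heckeEisensteinSplit_of : E32a → E32b → E30 = PrymDefectHeckeEisensteinSplit` — GRANTED that named fact, with
the fact's body carried as an explicit hypothesis `H` (`prymLattice_le_shiftSubOneLattice_sup_span_of_periodKernel`)
and instantiated (`prymLatticeFixedPointSpan_of_periodKernelFact`, the item's statement VERBATIM behind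
`(H : periodFunctional_ker_le_ellipticParabolic_sup_commutator)`).  Everything here is a THEOREM; no new fact, no
instance, no notation, no `sorry`; nothing about any elliptic curve is asserted.

## The statement and why it is the «fixed-point span»

For `9 ∣ N` the quotient `Q = Λ_P/Λ₁ = H¹(⟨t⟩, Λ)` (an `𝔽₃`-space, `3Λ_P ⊆ Λ₁`) is the Hilbert-90 defect of the
cyclic triple cover `π : X₀(N) → X₀(N)/⟨t⟩ ≅ X₀(N/3)`.  The claim is that `Q` is spanned by the classes
`{∞, γ∞}`, `γ ∈ Γ₀(N)` with `|3(a + d) − c| ≤ 6`, i.e. `|tr(t⁻¹γ)| ≤ 2`: then `e = t⁻¹γ ∈ Γ̃ = ⟨Γ₀(N), t⟩` is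
parabolic or elliptic, fixes a point `x` (a cusp with `9 ∣` denominator-class, or a CM point by `ℤ[ζ₃]`), and
`{∞, γ∞} ≡ {x, tx} (mod Λ₁)` is the symbol of the `t`-FIXED POINT `x̄ ∈ X₀(N)`.

## Proof (group theory of `Γ₀(N/3) ⊇ diag(3,1)Γ₀(N)diag(3,1)⁻¹`, no Jacobian / uniformisation)

Conjugating by `D = diag(3,1)` identifies `Γ̃` with `G = Γ₀(N/3)` (`t ↦ T = (1 1; 0 1)`) and `Γ₀(N)` with the
index-`3` normal subgroup `H = DΓ₀(N)D⁻¹ = {3 ∣ b}` (the tree's `Gamma0.degeneracyConj (N/3) N 3`; coset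
decomposition `G = ⋃_{i<3} Tⁱ H`, `exists_eq_gamma0T_pow_mul_degeneracyConj`).
* The LIFTED SYMBOL `Ψ(g) = {∞, (g∞)/3} ∈ Λ_N` of `g = (a b; c d) ∈ G` (`liftedSymbol`; the cusp `a/(3c)` is a
  `Γ₀(N)`-translate of `∞` since `3 ∣ c`, `3 ∤ a`) satisfies `Ψ(DγD⁻¹) = {∞, γ∞}` (`liftedSymbol_degeneracyConj`),
  `Ψ(Tg) = t_*Ψ(g)` (`liftedSymbol_gamma0T_mul`; by `{∞, r}_{f∣t} = {∞, r + 1/3}_f`, `modularSymbol_shiftCuspForm`)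
  and the crossed-homomorphism rule `Ψ(gg') = Ψ(g) + t_*ⁱΨ(g')` for `g ∈ TⁱH` (`exists_liftedSymbol_mul`; the
  explicit conjugates `tᵉγt⁻ᵉ ∈ Γ₀(N)`, `shiftConjElt`, move powers of `T` across `H`); hence `Ψ mod Λ₁` is a
  HOMOMORPHISM `G → Λ/Λ₁` (`liftedSymbolModHom`), killing commutators.
* A parabolic or elliptic `g ∈ G` (`|tr g| ≤ 2`) has `Ψ(g) ∈ Λ₁ + F`, `F` the span of the fixed-point symbols
  (`liftedSymbol_mem_of_isParabolic_or_isElliptic`): with `g = TⁱDγD⁻¹`, for `i = 0` `Ψ(g) = {∞, γ∞} = 0`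
  (`tr γ = tr g`, the tree's `cuspSymbol_eq_zero_of_discr_eq_zero` / `periodFunctional_eq_zero_of_isElliptic`); for
  `i = 1` `Ψ(g) = t_*{∞, γ∞} = −{∞, γ'∞}` with `γ' = tγ⁻¹t⁻¹`; for `i = 2` `Ψ(g) = t_*²{∞, γ'∞} ≡ {∞, γ'∞}` with
  `γ' = t³γ`; in both cases `3(a' + d') − c' = 3 tr g`, so `|3(a' + d') − c'| ≤ 6`.
* MAIN (`prymLattice_le_shiftSubOneLattice_sup_span_of_periodKernel`): `y ∈ Λ_P = ker π_*`
  (`ker_pushforwardInt_eq_prymLattice`), `y = {∞, γ₀∞}` and `π_*{∞, γ₀∞}_N = {∞, (Dγ₀D⁻¹)∞}_{N/3}`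
  (`dualMap_degeneracyMap0_periodFunctional`), so `Dγ₀D⁻¹ ∈ Γ₀(N/3)` has ZERO PERIODS; by Knapp's presentation
  of `H₁(X₀(N/3), ℤ)` (the fact, at level `N/3`) it lies in `Γ_ep(N/3)·[G, G]`; the set of `g` with
  `Ψ(g) ∈ Λ₁ + F` is a subgroup containing `Γ_ep(N/3)` and the commutators, hence contains `Dγ₀D⁻¹`, and
  `Ψ(Dγ₀D⁻¹) = {∞, γ₀∞} = y`.
This is the five-term / Hilbert-90 computation of `H₁(Γ̃; ·)` versus the `C₃`-coinvariants of `H₁(Γ₀(N))`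
(Lange–Rodríguez §3.2: pull-back and norm for a cyclic cover; Mumford, Prym varieties I, §3: invariant classes
come from pull-backs and ramification points), carried out on Manin's presentation.  The INTEGRAL input is
exactly Knapp's Prop. 11.22 for `Γ₀(N/3)`; the tree's rational results would only give `3ʲy ∈ Λ₁ + F`.

## References

* A. W. Knapp, *Elliptic Curves*, Math. Notes 40 (1993), Prop. 11.22, (11.36)–(11.37), (11.42)
  (PDF pp. 242–246). [Knapp1993]
* Ju. I. Manin, *Parabolic points and zeta functions of modular curves*, Izv. 36 (1972), §1.5, Prop. 1.4,
  Thm. 1.9. [Manin1972]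
* H. Lange, R. E. Rodríguez, *Decomposition of Jacobians by Prym varieties*, LNM 2310 (2022), §3.2.1 (PDF p. 55),
  Prop. 3.5.1 (p. 67). [LangeRodriguez2022]
* G. Shimura, *Introduction to the arithmetic theory of automorphic functions* (1971), §1.3 (parabolic and
  elliptic elements), Prop. 3.64 (`[1, u/m; 0, 1]` normalises `Γ₀(m²M)`). [Shimura1971]
* M. Harrison, *A new automorphism of `X₀(108)`* (2011), §2 (the automorphism `S₃ : τ ↦ τ + 1/3` of `X₀(N)`,
  `9 ∣ N`). [Harrison2011X0108]
* J. E. Cremona, *Algorithms for modular elliptic curves*, 2nd ed. (1997), §2.1 (2.1.1), Lemma 2.1.1.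
  [CremonaAlgorithms1997]
-/

noncomputable section

open scoped MatrixGroups ModularForm

open CongruenceSubgroup UpperHalfPlane
open Literature.NumberTheory.EllipticCurves.ModularForms

namespace Literature.NumberTheory.ModularSymbols

/-! ### Plumbing: entries of elements of `Γ₀(·)` -/

section Plumbing

/-- An element of `Γ₀(N)` is determined by the four entries of its matrix (plumbing). [folklore] -/
private theorem Gamma0.ext_apply {N : ℕ} {γ δ : Gamma0 N}
    (h : ∀ i j, (γ : SL(2, ℤ)) i j = (δ : SL(2, ℤ)) i j) : γ = δ :=
  Subtype.ext (Matrix.SpecialLinearGroup.ext _ _ h)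

/-- `ad − bc = 1` for an element of `SL(2, ℤ)` (plumbing). [folklore] -/
private theorem det_entries' (γ : SL(2, ℤ)) : γ 0 0 * γ 1 1 - γ 0 1 * γ 1 0 = 1 := by
  have := Matrix.det_fin_two (γ : Matrix (Fin 2) (Fin 2) ℤ)
  rw [Matrix.SpecialLinearGroup.det_coe] at this
  linear_combination -this

/-- `N ∣ c` for `(a b; c d) ∈ Γ₀(N)` (plumbing). [folklore] -/
private theorem natCast_dvd_apply_one_zero {N : ℕ} (γ : Gamma0 N) : (N : ℤ) ∣ (γ : SL(2, ℤ)) 1 0 := by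
  have hγ := γ.2
  rw [Gamma0_mem] at hγ
  exact (ZMod.intCast_zmod_eq_zero_iff_dvd _ N).mp hγ

/-- `3 ∣ N/3` when `9 ∣ N` (plumbing). [folklore] -/
private theorem three_dvd_div_three {N : ℕ} (h9 : 3 ^ 2 ∣ N) : 3 ∣ N / 3 :=
  Nat.dvd_div_of_mul_dvd (by simpa [pow_two] using h9)

/-- `3 ∣ N` when `9 ∣ N` (plumbing). [folklore] -/
private theorem three_dvd {N : ℕ} (h9 : 3 ^ 2 ∣ N) : 3 ∣ N :=
  (dvd_pow_self 3 two_ne_zero).trans h9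

/-- `N/3 · 3 ∣ N` when `3 ∣ N` (the hypothesis shape of `Gamma0.degeneracyConj (N/3) N 3`). [cite: Harrison2011X0108, §2] -/
theorem div_three_mul_three_dvd' {N : ℕ} (h9 : 3 ^ 2 ∣ N) : N / 3 * 3 ∣ N :=
  dvd_of_eq (Nat.div_mul_cancel (three_dvd h9))

/-- `(N : ℤ) = 3 · (N/3)` when `3 ∣ N` (plumbing). [folklore] -/
private theorem natCast_eq_three_mul_div {N : ℕ} (h9 : 3 ^ 2 ∣ N) : (N : ℤ) = 3 * ((N / 3 : ℕ) : ℤ) := by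
  have h := congrArg (Nat.cast : ℕ → ℤ) (Nat.mul_div_cancel' (three_dvd h9)).symm
  rw [Nat.cast_mul] at h
  exact_mod_cast h

/-- If `3 ∣ c` for `(a b; c d) ∈ SL(2, ℤ)` then `a d ≡ 1 (mod 3)`, so in `ZMod 3`: `a = d` and `d² = 1`
(the units of `ℤ/3` are `±1`). [folklore] -/
private theorem zmod_three_entries {γ : SL(2, ℤ)} (h3 : (3 : ℤ) ∣ γ 1 0) :
    ((γ 0 0 : ℤ) : ZMod 3) = ((γ 1 1 : ℤ) : ZMod 3) ∧ ((γ 1 1 : ℤ) : ZMod 3) ^ 2 = 1 := by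
  have hdet := det_entries' γ
  have hc : ((γ 1 0 : ℤ) : ZMod 3) = 0 := (ZMod.intCast_zmod_eq_zero_iff_dvd _ 3).mpr (by exact_mod_cast h3)
  have had : ((γ 0 0 : ℤ) : ZMod 3) * ((γ 1 1 : ℤ) : ZMod 3) = 1 := by
    have h := congrArg (Int.cast : ℤ → ZMod 3) hdet
    push_cast at h
    rw [hc, mul_zero, sub_zero] at h
    exact h
  revert had
  generalize ((γ 0 0 : ℤ) : ZMod 3) = x
  generalize ((γ 1 1 : ℤ) : ZMod 3) = y
  revert x y
  decide

/-- `3 ∣ a − d` for `(a b; c d) ∈ SL(2, ℤ)` with `3 ∣ c`. [folklore] -/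
private theorem three_dvd_sub_of_three_dvd {γ : SL(2, ℤ)} (h3 : (3 : ℤ) ∣ γ 1 0) :
    (3 : ℤ) ∣ γ 0 0 - γ 1 1 := by
  have h := (zmod_three_entries h3).1
  have h' : (((γ 0 0 - γ 1 1 : ℤ)) : ZMod 3) = 0 := by
    push_cast
    rw [h, sub_self]
  exact_mod_cast (ZMod.intCast_zmod_eq_zero_iff_dvd _ 3).mp h'

end Plumbing

/-! ### Modular symbols depend only on the cusp `γ∞`; the shift moves the cusp by `1/3` -/

section Shift

variable (N : ℕ) [NeZero N] (h9 : 3 ^ 2 ∣ N)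

/-- **`{∞, r}_{f∣t} = {∞, r + 1/3}_f`** (`t = [1, 1/3; 0, 1]`, `(f∣t)(τ) = f(τ + 1/3)`): the vertical ray
above `r` shifts to the vertical ray above `r + 1/3` (as in the tree's `eichlerIntegral_shiftCuspForm`).
[cite: Manin1972, §1.5 and Prop. 1.4] -/
theorem modularSymbol_shiftCuspForm (f : CuspForm (Gamma0 N) 2) (r : ℚ) :
    modularSymbol (shiftCuspForm N h9 f) r = modularSymbol f (r + 1 / 3) := by
  simp only [modularSymbol]
  congr 1
  refine MeasureTheory.setIntegral_congr_fun measurableSet_Ioi fun s hs ↦ ?_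
  rw [shiftCuspForm_apply]
  congr 1
  have hs' : 0 < s := Set.mem_Ioi.mp hs
  have h1 : 0 < ((r : ℂ) + s * Complex.I).im := by simpa using hs'
  have h2 : 0 < ((((r + 1 / 3 : ℚ)) : ℂ) + s * Complex.I).im := by simpa using hs'
  ext1
  rw [coe_vadd, ofComplex_apply_of_im_pos h1, ofComplex_apply_of_im_pos h2]
  push_cast
  ring

/-- **The modular symbol `{∞, γ∞}` depends only on the first column of `γ`** (i.e. on the cusp
`γ∞ = a/c`). [cite: CremonaAlgorithms1997, §2.1 (2.1.1)] -/
theorem symbolInt_eq_of_apply_eq {γ γ' : Gamma0 N} (h0 : (γ : SL(2, ℤ)) 0 0 = (γ' : SL(2, ℤ)) 0 0)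
    (h1 : (γ : SL(2, ℤ)) 1 0 = (γ' : SL(2, ℤ)) 1 0) : symbolInt N γ = symbolInt N γ' := by
  apply Subtype.ext
  ext f
  simp [cuspSymbol, h0, h1]

/-- **The shift on modular symbols moves the cusp by `1/3`**: if `γ, γ' ∈ Γ₀(N)` have first columns
`(a, c)` and `(a', c)` with `3a' = 3a + c` (i.e. `a'/c = a/c + 1/3`), then `t_*{∞, γ∞} = {∞, γ'∞}`
(`{∞, a/c}_{f∣t} = {∞, a/c + 1/3}_f`). [cite: Manin1972, §1.5 and Prop. 1.4] -/
theorem shiftInt_symbolInt_eq_of_col {γ γ' : Gamma0 N} (h1 : (γ' : SL(2, ℤ)) 1 0 = (γ : SL(2, ℤ)) 1 0)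
    (h0 : 3 * (γ' : SL(2, ℤ)) 0 0 = 3 * (γ : SL(2, ℤ)) 0 0 + (γ : SL(2, ℤ)) 1 0) :
    shiftInt N h9 (symbolInt N γ) = symbolInt N γ' := by
  apply Subtype.ext
  ext f
  rw [coe_shiftInt_apply, symbolInt_apply, symbolInt_apply]
  by_cases hc : (γ : SL(2, ℤ)) 1 0 = 0
  · have hc' : (γ' : SL(2, ℤ)) 1 0 = 0 := by rw [h1, hc]
    simp [cuspSymbol, hc, hc']
  · have hc' : (γ' : SL(2, ℤ)) 1 0 ≠ 0 := by rwa [h1]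
    rw [cuspSymbol, if_neg hc, cuspSymbol, if_neg hc', modularSymbol_shiftCuspForm, h1]
    congr 1
    have hcq : ((γ : SL(2, ℤ)) 1 0 : ℚ) ≠ 0 := by exact_mod_cast hc
    have h0q : (3 : ℚ) * ((γ' : SL(2, ℤ)) 0 0 : ℚ) = 3 * ((γ : SL(2, ℤ)) 0 0 : ℚ) + ((γ : SL(2, ℤ)) 1 0 : ℚ) := by
      exact_mod_cast h0
    have e : (((γ' : SL(2, ℤ)) 0 0 : ℤ) : ℚ) = ((γ : SL(2, ℤ)) 0 0 : ℚ) + ((γ : SL(2, ℤ)) 1 0 : ℚ) / 3 := by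
      linear_combination h0q / 3
    rw [e]
    field_simp

end Shift

/-! ### The group `Γ₀(N/3) ⊇ diag(3,1) Γ₀(N) diag(3,1)⁻¹` and the lifted symbols `{∞, (g∞)/3}` -/

section ShiftGen

variable (M : ℕ)

/-- The element `T = (1 1; 0 1)` of `Γ₀(M)` (for `M = N/3`: the image of the shift `t = [1, 1/3; 0, 1]` under
`diag(3,1)`-conjugation; for `M = N`: `t³`). [cite: Shimura1971, §1.3] -/
def gamma0T : Gamma0 M :=
  ⟨ModularGroup.T, by rw [Gamma0_mem]; simp [ModularGroup.coe_T]⟩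

/-- The matrix of `gamma0T` is `T = (1 1; 0 1)`. [cite: Shimura1971, §1.3] -/
@[simp] theorem coe_gamma0T : ((gamma0T M : Gamma0 M) : SL(2, ℤ)) = ModularGroup.T := rfl

/-- The matrix of `gamma0T ^ i` is `Tⁱ = (1 i; 0 1)`. [cite: Shimura1971, §1.3] -/
theorem coe_gamma0T_pow (i : ℕ) :
    ((gamma0T M ^ i : Gamma0 M) : SL(2, ℤ)) = ModularGroup.T ^ (i : ℤ) := by
  rw [Subgroup.coe_pow, coe_gamma0T, zpow_natCast]

/-- Entries of `Tʲ γ` (plumbing; as in the tree's `T_zpow_mul_apply`). [folklore] -/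
private theorem T_zpow_mul_apply' (j : ℤ) (γ : SL(2, ℤ)) :
    (ModularGroup.T ^ j * γ) 0 0 = γ 0 0 + j * γ 1 0 ∧ (ModularGroup.T ^ j * γ) 0 1 = γ 0 1 + j * γ 1 1 ∧
      (ModularGroup.T ^ j * γ) 1 0 = γ 1 0 ∧ (ModularGroup.T ^ j * γ) 1 1 = γ 1 1 := by
  refine ⟨?_, ?_, ?_, ?_⟩ <;>
    simp [Matrix.SpecialLinearGroup.coe_mul, ModularGroup.coe_T_zpow, Matrix.mul_apply,
      Fin.sum_univ_two]

/-- Entries of `γ Tʲ` (plumbing; as in the tree's `mul_T_zpow_apply`). [folklore] -/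
private theorem mul_T_zpow_apply' (j : ℤ) (γ : SL(2, ℤ)) :
    (γ * ModularGroup.T ^ j) 0 0 = γ 0 0 ∧ (γ * ModularGroup.T ^ j) 0 1 = γ 0 0 * j + γ 0 1 ∧
      (γ * ModularGroup.T ^ j) 1 0 = γ 1 0 ∧ (γ * ModularGroup.T ^ j) 1 1 = γ 1 0 * j + γ 1 1 := by
  refine ⟨?_, ?_, ?_, ?_⟩ <;>
    simp [Matrix.SpecialLinearGroup.coe_mul, ModularGroup.coe_T_zpow, Matrix.mul_apply,
      Fin.sum_univ_two]

/-- Entries of `Tⁱ g` in `Γ₀(M)`: `(a + i c, b + i d; c, d)`. [cite: Shimura1971, §1.3] -/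
theorem gamma0T_pow_mul_apply (i : ℕ) (g : Gamma0 M) :
    ((gamma0T M ^ i * g : Gamma0 M) : SL(2, ℤ)) 0 0 = (g : SL(2, ℤ)) 0 0 + i * (g : SL(2, ℤ)) 1 0 ∧
    ((gamma0T M ^ i * g : Gamma0 M) : SL(2, ℤ)) 0 1 = (g : SL(2, ℤ)) 0 1 + i * (g : SL(2, ℤ)) 1 1 ∧
    ((gamma0T M ^ i * g : Gamma0 M) : SL(2, ℤ)) 1 0 = (g : SL(2, ℤ)) 1 0 ∧
    ((gamma0T M ^ i * g : Gamma0 M) : SL(2, ℤ)) 1 1 = (g : SL(2, ℤ)) 1 1 := by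
  rw [Subgroup.coe_mul, coe_gamma0T_pow]
  exact T_zpow_mul_apply' i g

/-- Entries of `T g` in `Γ₀(M)`: `(a + c, b + d; c, d)`. [cite: Shimura1971, §1.3] -/
theorem gamma0T_mul_apply (g : Gamma0 M) :
    ((gamma0T M * g : Gamma0 M) : SL(2, ℤ)) 0 0 = (g : SL(2, ℤ)) 0 0 + (g : SL(2, ℤ)) 1 0 ∧
    ((gamma0T M * g : Gamma0 M) : SL(2, ℤ)) 0 1 = (g : SL(2, ℤ)) 0 1 + (g : SL(2, ℤ)) 1 1 ∧
    ((gamma0T M * g : Gamma0 M) : SL(2, ℤ)) 1 0 = (g : SL(2, ℤ)) 1 0 ∧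
    ((gamma0T M * g : Gamma0 M) : SL(2, ℤ)) 1 1 = (g : SL(2, ℤ)) 1 1 := by
  have h := gamma0T_pow_mul_apply M 1 g
  simp only [pow_one, Nat.cast_one, one_mul] at h
  exact h

/-- Entries of `g T` in `Γ₀(M)`: `(a, a + b; c, c + d)`. [cite: Shimura1971, §1.3] -/
theorem mul_gamma0T_apply (g : Gamma0 M) :
    ((g * gamma0T M : Gamma0 M) : SL(2, ℤ)) 0 0 = (g : SL(2, ℤ)) 0 0 ∧
    ((g * gamma0T M : Gamma0 M) : SL(2, ℤ)) 0 1 = (g : SL(2, ℤ)) 0 0 + (g : SL(2, ℤ)) 0 1 ∧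
    ((g * gamma0T M : Gamma0 M) : SL(2, ℤ)) 1 0 = (g : SL(2, ℤ)) 1 0 ∧
    ((g * gamma0T M : Gamma0 M) : SL(2, ℤ)) 1 1 = (g : SL(2, ℤ)) 1 0 + (g : SL(2, ℤ)) 1 1 := by
  have h := mul_T_zpow_apply' 1 (g : SL(2, ℤ))
  rw [zpow_one] at h
  rw [Subgroup.coe_mul, coe_gamma0T]
  simpa [mul_one] using h

end ShiftGen

section Columns

variable (N : ℕ) (h9 : 3 ^ 2 ∣ N)

include h9

/-- `3` divides the lower-left entry of every `g ∈ Γ₀(N/3)` (`9 ∣ N`). [cite: Harrison2011X0108, §2] -/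
theorem three_dvd_apply_one_zero (g : Gamma0 (N / 3)) : (3 : ℤ) ∣ (g : SL(2, ℤ)) 1 0 :=
  (Int.natCast_dvd_natCast.mpr (three_dvd_div_three h9)).trans (natCast_dvd_apply_one_zero g)

/-- For `g = (a b; c d) ∈ Γ₀(N/3)` (`9 ∣ N`) the column `(a, 3c)` is coprime (`3 ∤ a` as `3 ∣ c`). [cite: Harrison2011X0108, §2] -/
theorem isCoprime_apply_three_mul (g : Gamma0 (N / 3)) :
    IsCoprime ((g : SL(2, ℤ)) 0 0) (3 * (g : SL(2, ℤ)) 1 0) := by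
  have hac : IsCoprime ((g : SL(2, ℤ)) 0 0) ((g : SL(2, ℤ)) 1 0) :=
    Matrix.SpecialLinearGroup.isCoprime_col (g : SL(2, ℤ)) 0
  have h3 : IsCoprime ((g : SL(2, ℤ)) 0 0) 3 := by
    refine (Int.prime_three.coprime_iff_not_dvd.mpr fun h ↦ ?_).symm
    exact Int.prime_three.not_unit (hac.isUnit_of_dvd' h (three_dvd_apply_one_zero N h9 g))
  exact h3.mul_right hac

/-- For `g = (a b; c d) ∈ Γ₀(N/3)`, `N ∣ 3c`. [cite: Harrison2011X0108, §2] -/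
theorem natCast_dvd_three_mul (g : Gamma0 (N / 3)) : (N : ℤ) ∣ 3 * (g : SL(2, ℤ)) 1 0 := by
  rw [natCast_eq_three_mul_div h9]
  exact mul_dvd_mul_left 3 (natCast_dvd_apply_one_zero g)

end Columns

section Lifted

variable (N : ℕ) [NeZero N] (h9 : 3 ^ 2 ∣ N)

/-- **The lifted symbol `{∞, (g∞)/3} ∈ H₁(X₀(N), ℤ)` of `g ∈ Γ₀(N/3)`** (`9 ∣ N`): for
`g = (a b; c d)` the cusp `(g∞)/3 = a/(3c)` is a `Γ₀(N)`-translate of `∞` (`gcd(a, 3c) = 1`, `N ∣ 3c`), and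
`{∞, (g∞)/3}` is the modular symbol `{∞, δ∞}` of any `δ ∈ Γ₀(N)` with first column `(a, 3c)`.  Under
`Γ₀(N/3) = diag(3,1) Γ̃ diag(3,1)⁻¹`, `Γ̃ = ⟨Γ₀(N), t⟩`, `t = [1, 1/3; 0, 1]`, this is the crossed homomorphism
`g̃ ↦ {∞, g̃∞}` on `Γ̃` extending `γ ↦ {∞, γ∞}` on `Γ₀(N)` (`liftedSymbol_degeneracyConj`) with
`t ↦ {∞, t∞} = 0`; it is the path-lifting map `H₁`-cocycle of the cyclic triple cover `X₀(N) → X₀(N/3)` used in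
the Hilbert-90 / five-term analysis of the `t`-coinvariants of `H₁(X₀(N), ℤ)`.
[cite: Manin1972, §1.5 and Prop. 1.4] [cite: LangeRodriguez2022, §3.2.1 (PDF p. 55)] -/
def liftedSymbol (g : Gamma0 (N / 3)) : periodHomologyHecke N :=
  symbolInt N (Gamma0.mkOfCol ((g : SL(2, ℤ)) 0 0) (3 * (g : SL(2, ℤ)) 1 0)
    (isCoprime_apply_three_mul N h9 g) (natCast_dvd_three_mul N h9 g))

/-- `liftedSymbol g = {∞, δ∞}` for ANY `δ ∈ Γ₀(N)` with first column `(a, 3c)`. [cite: CremonaAlgorithms1997, §2.1 (2.1.1)] -/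
theorem liftedSymbol_eq_symbolInt (g : Gamma0 (N / 3)) {δ : Gamma0 N}
    (h0 : (δ : SL(2, ℤ)) 0 0 = (g : SL(2, ℤ)) 0 0) (h1 : (δ : SL(2, ℤ)) 1 0 = 3 * (g : SL(2, ℤ)) 1 0) :
    liftedSymbol N h9 g = symbolInt N δ :=
  symbolInt_eq_of_apply_eq N (by simp [h0]) (by simp [h1])

/-- **`{∞, (Tg∞)/3} = t_*{∞, (g∞)/3}`**: left multiplication by `T` on `Γ₀(N/3)` is the shift `t_*` on the
lifted symbols (the cusp `a/(3c)` moves to `(a + c)/(3c) = a/(3c) + 1/3`). [cite: Manin1972, §1.5 and Prop. 1.4] -/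
theorem liftedSymbol_gamma0T_mul (g : Gamma0 (N / 3)) :
    liftedSymbol N h9 (gamma0T (N / 3) * g) = shiftInt N h9 (liftedSymbol N h9 g) := by
  obtain ⟨h00, -, h10, -⟩ := gamma0T_mul_apply (N / 3) g
  unfold liftedSymbol
  symm
  apply shiftInt_symbolInt_eq_of_col N h9
  · rw [Gamma0.mkOfCol_apply_one_zero, Gamma0.mkOfCol_apply_one_zero, h10]
  · rw [Gamma0.mkOfCol_apply_zero_zero, Gamma0.mkOfCol_apply_zero_zero, Gamma0.mkOfCol_apply_one_zero, h00]
    ring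

/-- `{∞, (Tⁱg∞)/3} = t_*ⁱ{∞, (g∞)/3}`. [cite: Manin1972, §1.5 and Prop. 1.4] -/
theorem liftedSymbol_gamma0T_pow_mul (g : Gamma0 (N / 3)) (i : ℕ) :
    liftedSymbol N h9 (gamma0T (N / 3) ^ i * g) = (shiftInt N h9 ^ i) (liftedSymbol N h9 g) := by
  induction i with
  | zero => simp
  | succ i ih => rw [pow_succ', mul_assoc, liftedSymbol_gamma0T_mul, ih, pow_succ', Module.End.mul_apply]

/-- **On `diag(3,1) Γ₀(N) diag(3,1)⁻¹` the lifted symbol is the ordinary one**: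
`{∞, ((DγD⁻¹)∞)/3} = {∞, γ∞}` for `γ ∈ Γ₀(N)`, `D = diag(3,1)` (`DγD⁻¹ = (a, 3b; c/3, d)`, cusp `a/(3·c/3) = a/c`).
[cite: DarmonDiamondTaylor1995, Lemma 4.28 (p. 135)] -/
theorem liftedSymbol_degeneracyConj (γ : Gamma0 N) :
    liftedSymbol N h9 (Gamma0.degeneracyConj (N / 3) N 3 (div_three_mul_three_dvd' h9) γ) = symbolInt N γ := by
  apply liftedSymbol_eq_symbolInt N h9
  · simp
  · simp only [Gamma0.degeneracyConj_apply, Gamma0.degeneracyConjElt_apply_one_zero, Nat.cast_ofNat]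
    exact (Int.mul_ediv_cancel' ((show (3 : ℤ) ∣ (3 : ℤ) ^ 2 from ⟨3, by norm_num⟩).trans
      (sq_dvd_entry_of_mem_Gamma0 (m := 3) h9 γ.2))).symm

/-- `{∞, (1∞)/3} = 0`. [cite: Manin1972, §1.5 and Prop. 1.4] -/
@[simp] theorem liftedSymbol_one : liftedSymbol N h9 1 = 0 := by
  have h := liftedSymbol_degeneracyConj N h9 1
  rwa [map_one, symbolInt_one] at h

end Lifted

/-! ### `Γ₀(N/3) = ⋃_{i<3} Tⁱ · diag(3,1) Γ₀(N) diag(3,1)⁻¹` and the lifted symbols of each coset -/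

section Decomposition

variable (N : ℕ) [NeZero N] (h9 : 3 ^ 2 ∣ N)

omit [NeZero N] in
/-- `diag(3,1) T_N diag(3,1)⁻¹ = T³` in `Γ₀(N/3)` (`t³ = T_N` on `X₀(N)`). [cite: Shimura1971, §1.3] -/
theorem degeneracyConj_gamma0T :
    Gamma0.degeneracyConj (N / 3) N 3 (div_three_mul_three_dvd' h9) (gamma0T N) = gamma0T (N / 3) ^ 3 := by
  apply Gamma0.ext_apply
  intro r s
  have h := gamma0T_pow_mul_apply (N / 3) 3 1
  simp only [mul_one] at h
  obtain ⟨h00, h01, h10, h11⟩ := h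
  fin_cases r <;> fin_cases s
  · simp only [Fin.zero_eta, Fin.isValue]
    rw [h00]
    simp [ModularGroup.coe_T]
  · simp only [Fin.zero_eta, Fin.mk_one, Fin.isValue]
    rw [h01]
    simp [ModularGroup.coe_T]
  · simp only [Fin.mk_one, Fin.zero_eta, Fin.isValue]
    rw [h10]
    simp [ModularGroup.coe_T]
  · simp only [Fin.mk_one, Fin.isValue]
    rw [h11]
    simp [ModularGroup.coe_T]

omit [NeZero N] in
/-- **Coset decomposition `Γ₀(N/3) = ⋃_{i = 0,1,2} Tⁱ · diag(3,1) Γ₀(N) diag(3,1)⁻¹`** (`9 ∣ N`): every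
`g = (a b; c d) ∈ Γ₀(N/3)` is `Tⁱ · (a', 3b'; c'/3, d')` with `i ≡ b d (mod 3)` and
`(a' b'; c' d') = (a − ic, (b − id)/3; 3c, d) ∈ Γ₀(N)` (`3 ∣ b − id` because `d² ≡ 1 (mod 3)`); i.e.
`Γ̃ = ⟨Γ₀(N), t⟩ ⊇ Γ₀(N)` has index `3` with `t` generating the quotient. [cite: Harrison2011X0108, §2] -/
theorem exists_eq_gamma0T_pow_mul_degeneracyConj (g : Gamma0 (N / 3)) :
    ∃ (i : ℕ) (γ : Gamma0 N), i < 3 ∧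
      g = gamma0T (N / 3) ^ i * Gamma0.degeneracyConj (N / 3) N 3 (div_three_mul_three_dvd' h9) γ := by
  have h3c : (3 : ℤ) ∣ (g : SL(2, ℤ)) 1 0 := three_dvd_apply_one_zero N h9 g
  have hdet := det_entries' (g : SL(2, ℤ))
  -- the exponent `i ≡ b d (mod 3)`
  set k : ℤ := ((g : SL(2, ℤ)) 0 1 * (g : SL(2, ℤ)) 1 1) % 3 with hk
  have hk0 : 0 ≤ k := Int.emod_nonneg _ (by norm_num)
  have hk3 : k < 3 := Int.emod_lt_of_pos _ (by norm_num)
  have hbd : (3 : ℤ) ∣ (g : SL(2, ℤ)) 0 1 - k * (g : SL(2, ℤ)) 1 1 := by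
    have h1 := (zmod_three_entries h3c).2
    have h' : ((((g : SL(2, ℤ)) 0 1 - k * (g : SL(2, ℤ)) 1 1 : ℤ)) : ZMod 3) = 0 := by
      have hkc : ((k : ℤ) : ZMod 3) = (((g : SL(2, ℤ)) 0 1 : ℤ) : ZMod 3) * (((g : SL(2, ℤ)) 1 1 : ℤ) : ZMod 3) := by
        rw [hk, Int.emod_def]
        push_cast
        rw [show (3 : ZMod 3) = 0 from rfl]
        ring
      push_cast
      rw [hkc]
      linear_combination (-(((g : SL(2, ℤ)) 0 1 : ℤ) : ZMod 3)) * h1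
    exact_mod_cast (ZMod.intCast_zmod_eq_zero_iff_dvd _ 3).mp h'
  have hbd' : 3 * (((g : SL(2, ℤ)) 0 1 - k * (g : SL(2, ℤ)) 1 1) / 3) =
      (g : SL(2, ℤ)) 0 1 - k * (g : SL(2, ℤ)) 1 1 := Int.mul_ediv_cancel' hbd
  have hNc : (N : ℤ) ∣ 3 * (g : SL(2, ℤ)) 1 0 := natCast_dvd_three_mul N h9 g
  -- the element of `Γ₀(N)`
  let A : Matrix (Fin 2) (Fin 2) ℤ :=
    !![(g : SL(2, ℤ)) 0 0 - k * (g : SL(2, ℤ)) 1 0, ((g : SL(2, ℤ)) 0 1 - k * (g : SL(2, ℤ)) 1 1) / 3;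
      3 * (g : SL(2, ℤ)) 1 0, (g : SL(2, ℤ)) 1 1]
  have hA : A.det = 1 := by
    rw [Matrix.det_fin_two_of]
    linear_combination hdet - ((g : SL(2, ℤ)) 1 0) * hbd'
  let γ : Gamma0 N := ⟨⟨A, hA⟩, by
    rw [Gamma0_mem]
    change (((3 * (g : SL(2, ℤ)) 1 0 : ℤ)) : ZMod N) = 0
    exact (ZMod.intCast_zmod_eq_zero_iff_dvd _ N).mpr hNc⟩
  have hγ00 : ((γ : Gamma0 N) : SL(2, ℤ)) 0 0 = (g : SL(2, ℤ)) 0 0 - k * (g : SL(2, ℤ)) 1 0 := rfl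
  have hγ01 : ((γ : Gamma0 N) : SL(2, ℤ)) 0 1 = ((g : SL(2, ℤ)) 0 1 - k * (g : SL(2, ℤ)) 1 1) / 3 := rfl
  have hγ10 : ((γ : Gamma0 N) : SL(2, ℤ)) 1 0 = 3 * (g : SL(2, ℤ)) 1 0 := rfl
  have hγ11 : ((γ : Gamma0 N) : SL(2, ℤ)) 1 1 = (g : SL(2, ℤ)) 1 1 := rfl
  refine ⟨k.toNat, γ, by omega, ?_⟩
  have hkn : ((k.toNat : ℕ) : ℤ) = k := Int.toNat_of_nonneg hk0
  obtain ⟨e00, e01, e10, e11⟩ := gamma0T_pow_mul_apply (N / 3) k.toNat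
    (Gamma0.degeneracyConj (N / 3) N 3 (div_three_mul_three_dvd' h9) γ)
  rw [hkn] at e00 e01
  apply Gamma0.ext_apply
  intro r s
  fin_cases r <;> fin_cases s
  · simp only [Fin.zero_eta, Fin.isValue]
    rw [e00, Gamma0.degeneracyConj_apply, Gamma0.degeneracyConjElt_apply_zero_zero,
      Gamma0.degeneracyConjElt_apply_one_zero, hγ00, hγ10, Nat.cast_ofNat,
      Int.mul_ediv_cancel_left _ (by norm_num : (3 : ℤ) ≠ 0)]
    ring
  · simp only [Fin.zero_eta, Fin.mk_one, Fin.isValue]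
    rw [e01, Gamma0.degeneracyConj_apply, Gamma0.degeneracyConjElt_apply_zero_one,
      Gamma0.degeneracyConjElt_apply_one_one, hγ01, hγ11, Nat.cast_ofNat, hbd']
    ring
  · simp only [Fin.mk_one, Fin.zero_eta, Fin.isValue]
    rw [e10, Gamma0.degeneracyConj_apply, Gamma0.degeneracyConjElt_apply_one_zero, hγ10, Nat.cast_ofNat,
      Int.mul_ediv_cancel_left _ (by norm_num : (3 : ℤ) ≠ 0)]
  · simp only [Fin.mk_one, Fin.isValue]
    rw [e11, Gamma0.degeneracyConj_apply, Gamma0.degeneracyConjElt_apply_one_one, hγ11]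

/-- **Lifted symbols on the coset `Tⁱ · diag(3,1) Γ₀(N) diag(3,1)⁻¹`**:
`{∞, ((Tⁱ DγD⁻¹)∞)/3} = t_*ⁱ {∞, γ∞}` (the crossed-homomorphism rule `Φ̃(tⁱγ) = Φ̃(tⁱ) + tⁱ·Φ̃(γ)` with
`Φ̃(tⁱ) = {∞, ∞} = 0`). [cite: Manin1972, §1.5 and Prop. 1.4] -/
theorem liftedSymbol_gamma0T_pow_mul_degeneracyConj (i : ℕ) (γ : Gamma0 N) :
    liftedSymbol N h9 (gamma0T (N / 3) ^ i * Gamma0.degeneracyConj (N / 3) N 3 (div_three_mul_three_dvd' h9) γ) =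
      (shiftInt N h9 ^ i) (symbolInt N γ) := by
  rw [liftedSymbol_gamma0T_pow_mul, liftedSymbol_degeneracyConj]

end Decomposition

/-! ### Conjugation by the shift: `tᵉ γ t⁻ᵉ ∈ Γ₀(N)` and `diag(3,1)(tᵉγt⁻ᵉ)diag(3,1)⁻¹ = Tᵉ (DγD⁻¹) T⁻ᵉ` -/

section ShiftConj

variable (N : ℕ) (h9 : 3 ^ 2 ∣ N)

include h9 in
/-- `9 ∣ c` for `(a b; c d) ∈ Γ₀(N)`, `9 ∣ N` (plumbing). [folklore] -/
private theorem nine_dvd_apply_one_zero (γ : Gamma0 N) : (9 : ℤ) ∣ (γ : SL(2, ℤ)) 1 0 := by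
  have h := sq_dvd_entry_of_mem_Gamma0 (m := 3) h9 γ.2
  norm_num at h
  exact h

/-- **The shift-conjugate `tᵉ γ t⁻ᵉ ∈ Γ₀(N)`** of `γ = (a b; c d) ∈ Γ₀(N)` (`9 ∣ N`, `t = [1, 1/3; 0, 1]`,
`e ∈ ℤ`): the integer matrix `(a + e c/3, b + e(d − a)/3 − e² c/9; c, d − e c/3)` (integral because `9 ∣ c`
and `a ≡ d (mod 3)`).  For `e = 1` this is the matrix of the tree's `shiftConj` (`t γ t⁻¹`, chosen there from
an existence statement); here all entries are explicit, which is what the level-`N/3` bookkeeping below needs.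
[cite: Shimura1971, Prop. 3.64] [cite: Harrison2011X0108, §2] -/
def shiftConjElt (e : ℤ) (γ : Gamma0 N) : Gamma0 N :=
  ⟨⟨!![(γ : SL(2, ℤ)) 0 0 + e * ((γ : SL(2, ℤ)) 1 0 / 3),
        (γ : SL(2, ℤ)) 0 1 + e * (((γ : SL(2, ℤ)) 1 1 - (γ : SL(2, ℤ)) 0 0) / 3) - e ^ 2 * ((γ : SL(2, ℤ)) 1 0 / 9);
      (γ : SL(2, ℤ)) 1 0, (γ : SL(2, ℤ)) 1 1 - e * ((γ : SL(2, ℤ)) 1 0 / 3)], by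
      have hdet := det_entries' (γ : SL(2, ℤ))
      have h9c := nine_dvd_apply_one_zero N h9 γ
      have h3c : (3 : ℤ) ∣ (γ : SL(2, ℤ)) 1 0 := (show (3 : ℤ) ∣ 9 by norm_num).trans h9c
      have e9 : 9 * ((γ : SL(2, ℤ)) 1 0 / 9) = (γ : SL(2, ℤ)) 1 0 := Int.mul_ediv_cancel' h9c
      have eδ : 3 * ((((γ : SL(2, ℤ)) 1 1 - (γ : SL(2, ℤ)) 0 0)) / 3) = (γ : SL(2, ℤ)) 1 1 - (γ : SL(2, ℤ)) 0 0 :=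
        Int.mul_ediv_cancel' (by
          have h := three_dvd_sub_of_three_dvd h3c
          rw [← dvd_neg] at h
          simpa using h)
      have e39 : (γ : SL(2, ℤ)) 1 0 / 3 = 3 * ((γ : SL(2, ℤ)) 1 0 / 9) := by
        obtain ⟨q, hq⟩ := h9c
        rw [hq, show (9 : ℤ) * q = 3 * (3 * q) by ring, Int.mul_ediv_cancel_left _ (by norm_num : (3 : ℤ) ≠ 0),
          show (3 : ℤ) * (3 * q) = 9 * q by ring, Int.mul_ediv_cancel_left _ (by norm_num : (9 : ℤ) ≠ 0)]
      rw [Matrix.det_fin_two_of]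
      -- with `c₉ = c/9`, `c/3 = 3c₉`, `3δ = d − a`: the determinant is `ad − bc`
      set c9 := (γ : SL(2, ℤ)) 1 0 / 9 with hc9
      set δ := (((γ : SL(2, ℤ)) 1 1 - (γ : SL(2, ℤ)) 0 0)) / 3 with hδ
      rw [e39]
      linear_combination hdet - (3 * e * c9) * eδ - (e ^ 2 * c9 - e * δ) * e9⟩, by
      rw [Gamma0_mem]
      change ((((γ : SL(2, ℤ)) 1 0 : ℤ)) : ZMod N) = 0
      exact (ZMod.intCast_zmod_eq_zero_iff_dvd _ N).mpr (natCast_dvd_apply_one_zero γ)⟩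

variable {N} in
/-- Entries of the shift-conjugate `tᵉ γ t⁻ᵉ` (plumbing). [cite: Shimura1971, Prop. 3.64] -/
theorem shiftConjElt_apply (e : ℤ) (γ : Gamma0 N) :
    ((shiftConjElt N h9 e γ : Gamma0 N) : SL(2, ℤ)) 0 0 = (γ : SL(2, ℤ)) 0 0 + e * ((γ : SL(2, ℤ)) 1 0 / 3) ∧
    ((shiftConjElt N h9 e γ : Gamma0 N) : SL(2, ℤ)) 0 1 =
      (γ : SL(2, ℤ)) 0 1 + e * (((γ : SL(2, ℤ)) 1 1 - (γ : SL(2, ℤ)) 0 0) / 3) - e ^ 2 * ((γ : SL(2, ℤ)) 1 0 / 9) ∧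
    ((shiftConjElt N h9 e γ : Gamma0 N) : SL(2, ℤ)) 1 0 = (γ : SL(2, ℤ)) 1 0 ∧
    ((shiftConjElt N h9 e γ : Gamma0 N) : SL(2, ℤ)) 1 1 = (γ : SL(2, ℤ)) 1 1 - e * ((γ : SL(2, ℤ)) 1 0 / 3) :=
  ⟨rfl, rfl, rfl, rfl⟩

/-- **`diag(3,1) (tᵉ γ t⁻ᵉ) diag(3,1)⁻¹ · Tᵉ = Tᵉ · diag(3,1) γ diag(3,1)⁻¹` in `Γ₀(N/3)`**
(`diag(3,1) t diag(3,1)⁻¹ = T`): the explicit conjugates realise conjugation by the powers of `T` on the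
index-`3` subgroup `diag(3,1) Γ₀(N) diag(3,1)⁻¹`. [cite: Shimura1971, Prop. 3.64] -/
theorem degeneracyConj_shiftConjElt_mul_zpow (e : ℤ) (γ : Gamma0 N) :
    Gamma0.degeneracyConj (N / 3) N 3 (div_three_mul_three_dvd' h9) (shiftConjElt N h9 e γ) * gamma0T (N / 3) ^ e =
      gamma0T (N / 3) ^ e * Gamma0.degeneracyConj (N / 3) N 3 (div_three_mul_three_dvd' h9) γ := by
  have h9c := nine_dvd_apply_one_zero N h9 γ
  have h3c : (3 : ℤ) ∣ (γ : SL(2, ℤ)) 1 0 := (show (3 : ℤ) ∣ 9 by norm_num).trans h9c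
  have eδ : 3 * ((((γ : SL(2, ℤ)) 1 1 - (γ : SL(2, ℤ)) 0 0)) / 3) = (γ : SL(2, ℤ)) 1 1 - (γ : SL(2, ℤ)) 0 0 :=
    Int.mul_ediv_cancel' (by
      have h := three_dvd_sub_of_three_dvd h3c
      rw [← dvd_neg] at h
      simpa using h)
  have e39 : (γ : SL(2, ℤ)) 1 0 / 3 = 3 * ((γ : SL(2, ℤ)) 1 0 / 9) := by
    obtain ⟨q, hq⟩ := h9c
    rw [hq, show (9 : ℤ) * q = 3 * (3 * q) by ring, Int.mul_ediv_cancel_left _ (by norm_num : (3 : ℤ) ≠ 0),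
      show (3 : ℤ) * (3 * q) = 9 * q by ring, Int.mul_ediv_cancel_left _ (by norm_num : (9 : ℤ) ≠ 0)]
  obtain ⟨s00, s01, s10, s11⟩ := shiftConjElt_apply h9 e γ
  -- entries of both sides
  have hL := mul_T_zpow_apply' e
    ((Gamma0.degeneracyConj (N / 3) N 3 (div_three_mul_three_dvd' h9) (shiftConjElt N h9 e γ) : Gamma0 (N / 3)) :
      SL(2, ℤ))
  have hR := T_zpow_mul_apply' e
    ((Gamma0.degeneracyConj (N / 3) N 3 (div_three_mul_three_dvd' h9) γ : Gamma0 (N / 3)) : SL(2, ℤ))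
  obtain ⟨l00, l01, l10, l11⟩ := hL
  obtain ⟨r00, r01, r10, r11⟩ := hR
  apply Gamma0.ext_apply
  intro r s
  rw [Subgroup.coe_mul, Subgroup.coe_zpow, coe_gamma0T, Subgroup.coe_mul, Subgroup.coe_zpow, coe_gamma0T]
  fin_cases r <;> fin_cases s
  · simp only [Fin.zero_eta, Fin.isValue]
    rw [l00, r00]
    simp only [Gamma0.degeneracyConj_apply, Gamma0.degeneracyConjElt_apply_zero_zero,
      Gamma0.degeneracyConjElt_apply_one_zero, s00, Nat.cast_ofNat]
  · simp only [Fin.zero_eta, Fin.mk_one, Fin.isValue]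
    rw [l01, r01]
    simp only [Gamma0.degeneracyConj_apply, Gamma0.degeneracyConjElt_apply_zero_zero,
      Gamma0.degeneracyConjElt_apply_zero_one, Gamma0.degeneracyConjElt_apply_one_one, s00, s01,
      Nat.cast_ofNat, e39]
    linear_combination e * eδ
  · simp only [Fin.mk_one, Fin.zero_eta, Fin.isValue]
    rw [l10, r10]
    simp only [Gamma0.degeneracyConj_apply, Gamma0.degeneracyConjElt_apply_one_zero, s10]
  · simp only [Fin.mk_one, Fin.isValue]
    rw [l11, r11]
    simp only [Gamma0.degeneracyConj_apply, Gamma0.degeneracyConjElt_apply_one_zero,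
      Gamma0.degeneracyConjElt_apply_one_one, s10, s11, Nat.cast_ofNat]
    ring

/-- `e = 1`: `diag(3,1)(tγt⁻¹)diag(3,1)⁻¹ · T = T · diag(3,1)γdiag(3,1)⁻¹`. [cite: Shimura1971, Prop. 3.64] -/
theorem degeneracyConj_shiftConjElt_one_mul (γ : Gamma0 N) :
    Gamma0.degeneracyConj (N / 3) N 3 (div_three_mul_three_dvd' h9) (shiftConjElt N h9 1 γ) * gamma0T (N / 3) =
      gamma0T (N / 3) * Gamma0.degeneracyConj (N / 3) N 3 (div_three_mul_three_dvd' h9) γ := by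
  have h := degeneracyConj_shiftConjElt_mul_zpow N h9 1 γ
  rwa [zpow_one] at h

/-- `e = −1`: `T · diag(3,1)(t⁻¹γt)diag(3,1)⁻¹ = diag(3,1)γdiag(3,1)⁻¹ · T`. [cite: Shimura1971, Prop. 3.64] -/
theorem gamma0T_mul_degeneracyConj_shiftConjElt_neg_one (γ : Gamma0 N) :
    gamma0T (N / 3) * Gamma0.degeneracyConj (N / 3) N 3 (div_three_mul_three_dvd' h9) (shiftConjElt N h9 (-1) γ) =
      Gamma0.degeneracyConj (N / 3) N 3 (div_three_mul_three_dvd' h9) γ * gamma0T (N / 3) := by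
  have h := degeneracyConj_shiftConjElt_mul_zpow N h9 (-1) γ
  rw [zpow_neg_one] at h
  -- `A T⁻¹ = T⁻¹ B` ⇒ `T A = B T`
  have h' := congrArg (fun x ↦ gamma0T (N / 3) * x * gamma0T (N / 3)) h
  simpa [mul_assoc] using h'

end ShiftConj

/-! ### The shift on the symbols of the conjugates, and the key commutation lemma -/

section ShiftConjSymbols

variable (N : ℕ) [NeZero N] (h9 : 3 ^ 2 ∣ N)

omit [NeZero N] in
include h9 in
/-- `3 · (c/3) = c` for the lower-left entry of `γ ∈ Γ₀(N)`, `9 ∣ N` (plumbing). [folklore] -/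
private theorem three_mul_apply_one_zero_div (γ : Gamma0 N) :
    3 * ((γ : SL(2, ℤ)) 1 0 / 3) = (γ : SL(2, ℤ)) 1 0 :=
  Int.mul_ediv_cancel' ((show (3 : ℤ) ∣ (3 : ℤ) ^ 2 from ⟨3, by norm_num⟩).trans
    (sq_dvd_entry_of_mem_Gamma0 (m := 3) h9 γ.2))

/-- **`{∞, (tγt⁻¹)∞} = t_*{∞, γ∞}`** for the explicit conjugate (cusp `(a + c/3)/c = a/c + 1/3`; the tree's
`shiftInt_symbolInt` for its chosen `shiftConj`). [cite: Manin1972, §1.5 and Prop. 1.4] -/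
theorem symbolInt_shiftConjElt_one (γ : Gamma0 N) :
    symbolInt N (shiftConjElt N h9 1 γ) = shiftInt N h9 (symbolInt N γ) := by
  obtain ⟨s00, -, s10, -⟩ := shiftConjElt_apply h9 1 γ
  symm
  apply shiftInt_symbolInt_eq_of_col N h9 s10
  rw [s00]
  linear_combination three_mul_apply_one_zero_div N h9 γ

/-- **`t_*{∞, (t⁻¹γt)∞} = {∞, γ∞}`** (cusp `(a − c/3)/c + 1/3 = a/c`). [cite: Manin1972, §1.5 and Prop. 1.4] -/
theorem shiftInt_symbolInt_shiftConjElt_neg_one (γ : Gamma0 N) :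
    shiftInt N h9 (symbolInt N (shiftConjElt N h9 (-1) γ)) = symbolInt N γ := by
  obtain ⟨s00, -, s10, -⟩ := shiftConjElt_apply h9 (-1) γ
  apply shiftInt_symbolInt_eq_of_col N h9 s10.symm
  rw [s00, s10]
  linear_combination three_mul_apply_one_zero_div N h9 γ

/-- **Moving `Tʲ` across `diag(3,1) Γ₀(N) diag(3,1)⁻¹`**: for `γ ∈ Γ₀(N)` and `j ≥ 0` there is
`γ̃ = t⁻ʲ γ tʲ ∈ Γ₀(N)` with `(DγD⁻¹) Tʲ = Tʲ (Dγ̃D⁻¹)` and `t_*ʲ{∞, γ̃∞} = {∞, γ∞}` (`D = diag(3,1)`).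
[cite: Shimura1971, Prop. 3.64] -/
theorem exists_degeneracyConj_mul_gamma0T_pow (j : ℕ) (γ : Gamma0 N) :
    ∃ γ' : Gamma0 N,
      Gamma0.degeneracyConj (N / 3) N 3 (div_three_mul_three_dvd' h9) γ * gamma0T (N / 3) ^ j =
        gamma0T (N / 3) ^ j * Gamma0.degeneracyConj (N / 3) N 3 (div_three_mul_three_dvd' h9) γ' ∧
      (shiftInt N h9 ^ j) (symbolInt N γ') = symbolInt N γ := by
  induction j with
  | zero => exact ⟨γ, by simp, by simp⟩
  | succ j ih =>
    obtain ⟨γ', h1, h2⟩ := ih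
    refine ⟨shiftConjElt N h9 (-1) γ', ?_, ?_⟩
    · rw [pow_succ, ← mul_assoc, h1, mul_assoc, ← gamma0T_mul_degeneracyConj_shiftConjElt_neg_one N h9 γ',
        mul_assoc]
    · rw [pow_succ, Module.End.mul_apply, shiftInt_symbolInt_shiftConjElt_neg_one, h2]

end ShiftConjSymbols

/-! ### The lifted symbols form a crossed homomorphism: `Ψ(gg') = Ψ(g) + tⁱ·Ψ(g')` -/

section Cocycle

variable (N : ℕ) [NeZero N] (h9 : 3 ^ 2 ∣ N)

/-- `t_*ⁱ x − x ∈ Λ₁ = (t − 1)Λ`. [cite: Harrison2011X0108, §2] -/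
theorem shiftInt_pow_sub_mem_shiftSubOneLattice (i : ℕ) (x : periodHomologyHecke N) :
    (shiftInt N h9 ^ i) x - x ∈ shiftSubOneLattice N h9 := by
  induction i with
  | zero => simp
  | succ i ih =>
    have e : (shiftInt N h9 ^ (i + 1)) x - x =
        (shiftInt N h9 ((shiftInt N h9 ^ i) x) - (shiftInt N h9 ^ i) x) + ((shiftInt N h9 ^ i) x - x) := by
      rw [pow_succ', Module.End.mul_apply]
      abel
    rw [e]
    exact add_mem (shiftInt_sub_mem_shiftSubOneLattice N h9 _) ih

/-- **Crossed-homomorphism rule for the lifted symbols**: for `g, g' ∈ Γ₀(N/3)` (`9 ∣ N`),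
`{∞, (gg'∞)/3} = {∞, (g∞)/3} + t_*ⁱ {∞, (g'∞)/3}` where `g ∈ Tⁱ · diag(3,1)Γ₀(N)diag(3,1)⁻¹` — the cocycle
identity `Φ̃(g̃g̃') = Φ̃(g̃) + g̃·Φ̃(g̃')` of `g̃ ↦ {∞, g̃∞}` on `Γ̃ = ⟨Γ₀(N), t⟩` acting on `H₁(X₀(N), ℤ)`
through `Γ̃/Γ₀(N) = ⟨t⟩` (Manin: `{∞, g̃g̃'∞} = {∞, g̃∞} + {g̃∞, g̃g̃'∞}`). [cite: Manin1972, §1.5 and Prop. 1.4] -/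
theorem exists_liftedSymbol_mul (g g' : Gamma0 (N / 3)) :
    ∃ i : ℕ, liftedSymbol N h9 (g * g') = liftedSymbol N h9 g + (shiftInt N h9 ^ i) (liftedSymbol N h9 g') := by
  obtain ⟨i, γ, -, rfl⟩ := exists_eq_gamma0T_pow_mul_degeneracyConj N h9 g
  obtain ⟨j, γ', -, rfl⟩ := exists_eq_gamma0T_pow_mul_degeneracyConj N h9 g'
  obtain ⟨γ'', h1, h2⟩ := exists_degeneracyConj_mul_gamma0T_pow N h9 j γ
  refine ⟨i, ?_⟩
  have e : gamma0T (N / 3) ^ i * Gamma0.degeneracyConj (N / 3) N 3 (div_three_mul_three_dvd' h9) γ *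
      (gamma0T (N / 3) ^ j * Gamma0.degeneracyConj (N / 3) N 3 (div_three_mul_three_dvd' h9) γ') =
      gamma0T (N / 3) ^ (i + j) * Gamma0.degeneracyConj (N / 3) N 3 (div_three_mul_three_dvd' h9) (γ'' * γ') := by
    rw [map_mul, pow_add, mul_assoc, ← mul_assoc (Gamma0.degeneracyConj (N / 3) N 3 _ γ), h1]
    simp only [mul_assoc]
  rw [e, liftedSymbol_gamma0T_pow_mul_degeneracyConj, liftedSymbol_gamma0T_pow_mul_degeneracyConj,
    liftedSymbol_gamma0T_pow_mul_degeneracyConj, symbolInt_mul, map_add, pow_add, Module.End.mul_apply,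
    Module.End.mul_apply, h2]

/-- **The lifted symbols are additive modulo `Λ₁ = (t − 1)Λ`**:
`{∞, (gg'∞)/3} − {∞, (g∞)/3} − {∞, (g'∞)/3} ∈ (t − 1)H₁(X₀(N), ℤ)` — so `g ↦ {∞, (g∞)/3} mod Λ₁` is a
homomorphism `Γ₀(N/3) → Λ/Λ₁` (the `t`-coinvariants). [cite: Manin1972, §1.5 and Prop. 1.4] -/
theorem liftedSymbol_mul_sub_sub_mem (g g' : Gamma0 (N / 3)) :
    liftedSymbol N h9 (g * g') - liftedSymbol N h9 g - liftedSymbol N h9 g' ∈ shiftSubOneLattice N h9 := by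
  obtain ⟨i, h⟩ := exists_liftedSymbol_mul N h9 g g'
  rw [h, add_sub_cancel_left]
  exact shiftInt_pow_sub_mem_shiftSubOneLattice N h9 i _

/-- **The lifted symbol modulo `Λ₁` as a group homomorphism** `Γ₀(N/3) → Λ/Λ₁` (written multiplicatively),
`g ↦ {∞, (g∞)/3} mod (t − 1)Λ`. [cite: Manin1972, §1.5 and Prop. 1.4] -/
def liftedSymbolModHom : Gamma0 (N / 3) →* Multiplicative (periodHomologyHecke N ⧸ shiftSubOneLattice N h9) where
  toFun g := Multiplicative.ofAdd ((shiftSubOneLattice N h9).mkQ (liftedSymbol N h9 g))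
  map_one' := by simp
  map_mul' g g' := by
    rw [← ofAdd_add, ← map_add]
    congr 1
    rw [← sub_eq_zero, ← map_sub, Submodule.mkQ_apply, Submodule.Quotient.mk_eq_zero, ← sub_sub]
    exact liftedSymbol_mul_sub_sub_mem N h9 g g'

/-- Unfolding `liftedSymbolModHom`. [cite: Manin1972, §1.5 and Prop. 1.4] -/
theorem liftedSymbolModHom_apply (g : Gamma0 (N / 3)) :
    liftedSymbolModHom N h9 g = Multiplicative.ofAdd ((shiftSubOneLattice N h9).mkQ (liftedSymbol N h9 g)) := rfl

end Cocycle

/-! ### Parabolic and elliptic elements of `Γ₀(N/3)` have lifted symbols in `Λ₁ + ℤ·{fixed-point symbols}` -/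

section FixedPoints

variable (N : ℕ) [NeZero N] (h9 : 3 ^ 2 ∣ N)

/-- The discriminant `tr² − 4` of `γ ∈ SL(2, ℤ)` in terms of its diagonal entries (plumbing). [cite: Shimura1971, §1.3] -/
private theorem discr_eq_sq_sub (γ : SL(2, ℤ)) :
    (γ : Matrix (Fin 2) (Fin 2) ℤ).discr = (γ 0 0 + γ 1 1) ^ 2 - 4 := by
  rw [Matrix.discr_fin_two, Matrix.trace_fin_two, Matrix.SpecialLinearGroup.det_coe]
  ring

/-- A `γ ∈ Γ₀(N)` with `tr² ≤ 4` (parabolic, elliptic or `±1`) has zero modular symbol `{∞, γ∞} = 0`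
(parabolic/scalar: the tree's `cuspSymbol_eq_zero_of_discr_eq_zero`; elliptic: finite order,
`periodFunctional_eq_zero_of_isElliptic`). [cite: Knapp1993, (11.36) (PDF p. 243)] -/
theorem symbolInt_eq_zero_of_discr_nonpos {γ : Gamma0 N}
    (h : ((γ : SL(2, ℤ)) : Matrix (Fin 2) (Fin 2) ℤ).discr ≤ 0) : symbolInt N γ = 0 := by
  rw [Subtype.ext_iff, coe_symbolInt, Submodule.coe_zero]
  rcases h.lt_or_eq with hlt | heq
  · exact periodFunctional_eq_zero_of_isElliptic hlt
  · ext f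
    exact cuspSymbol_eq_zero_of_discr_eq_zero f heq

/-- `{∞, T∞} = 0` for `T = (1 1; 0 1) ∈ Γ₀(N)`. [cite: CremonaAlgorithms1997, §2.1 Lemma 2.1.1 (1)] -/
@[simp] theorem symbolInt_gamma0T : symbolInt N (gamma0T N) = 0 := by
  rw [Subtype.ext_iff, coe_symbolInt, Submodule.coe_zero]
  exact periodFunctional_eq_zero_of_apply_one_zero (by simp [ModularGroup.coe_T])

omit [NeZero N] in
/-- Entries of `γ⁻¹ = (d −b; −c a)` in `Γ₀(N)` (plumbing). [folklore] -/
private theorem inv_apply (γ : Gamma0 N) :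
    ((γ⁻¹ : Gamma0 N) : SL(2, ℤ)) 0 0 = (γ : SL(2, ℤ)) 1 1 ∧ ((γ⁻¹ : Gamma0 N) : SL(2, ℤ)) 1 0 = -(γ : SL(2, ℤ)) 1 0 ∧
      ((γ⁻¹ : Gamma0 N) : SL(2, ℤ)) 1 1 = (γ : SL(2, ℤ)) 0 0 := by
  refine ⟨?_, ?_, ?_⟩ <;>
    simp [Matrix.SpecialLinearGroup.coe_inv, Matrix.adjugate_fin_two]

/-- **The generators of Knapp's `Γ_ep(N/3)` have lifted symbols in `Λ₁ + F`**, `F` the span of the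
fixed-point symbols `{∞, γ'∞}`, `γ' ∈ Γ₀(N)` with `|3(a'+d') − c'| ≤ 6` (i.e. `|tr(t⁻¹γ')| ≤ 2`): for a parabolic
or elliptic `g ∈ Γ₀(N/3)` (`|tr g| ≤ 2`), writing `g = Tⁱ DγD⁻¹` (`i ∈ {0,1,2}`, `D = diag(3,1)`):
`i = 0`: `{∞, (g∞)/3} = {∞, γ∞} = 0` (`tr γ = tr g`); `i = 1`: `{∞, (g∞)/3} = t_*{∞, γ∞} = −{∞, γ'∞}` with
`γ' = t γ⁻¹ t⁻¹`, `3(a'+d') − c' = 3 tr g`; `i = 2`: `{∞, (g∞)/3} = t_*²{∞, γ'∞} ≡ {∞, γ'∞} (mod Λ₁)` with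
`γ' = T_N γ = t³γ`, `3(a'+d') − c' = 3 tr g`.  These are the FIXED-POINT SYMBOLS of the cusps / CM points of
`X₀(N)` fixed by `t` (the parabolic/elliptic `t⁻¹γ' ∈ Γ̃` fixes a point `x`, and `{∞, γ'∞} ≡ {x, tx}`).
[cite: Manin1972, §1.5 and Prop. 1.4] [cite: Knapp1993, Prop. 11.22 (PDF p. 242)] -/
theorem liftedSymbol_mem_of_isParabolic_or_isElliptic (g : Gamma0 (N / 3))
    (hg : ((g : SL(2, ℤ)) : Matrix (Fin 2) (Fin 2) ℤ).IsParabolic ∨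
      ((g : SL(2, ℤ)) : Matrix (Fin 2) (Fin 2) ℤ).IsElliptic) :
    liftedSymbol N h9 g ∈ shiftSubOneLattice N h9 ⊔ Submodule.span ℤ {x | ∃ γ : Gamma0 N,
      |3 * ((γ : SL(2, ℤ)) 0 0 + (γ : SL(2, ℤ)) 1 1) - (γ : SL(2, ℤ)) 1 0| ≤ 6 ∧ symbolInt N γ = x} := by
  have htr : |(g : SL(2, ℤ)) 0 0 + (g : SL(2, ℤ)) 1 1| ≤ 2 := abs_trace_le_two_of_isParabolic_or_isElliptic hg
  have hdisc : ((g : SL(2, ℤ)) : Matrix (Fin 2) (Fin 2) ℤ).discr ≤ 0 := by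
    rcases hg with hp | he
    · exact hp.2.le
    · exact he.le
  obtain ⟨i, γ, hi, rfl⟩ := exists_eq_gamma0T_pow_mul_degeneracyConj N h9 g
  obtain ⟨e00, -, -, e11⟩ := gamma0T_pow_mul_apply (N / 3) i
    (Gamma0.degeneracyConj (N / 3) N 3 (div_three_mul_three_dvd' h9) γ)
  have hc00 : ((Gamma0.degeneracyConj (N / 3) N 3 (div_three_mul_three_dvd' h9) γ : Gamma0 (N / 3)) :
      SL(2, ℤ)) 0 0 = (γ : SL(2, ℤ)) 0 0 := rfl
  have hc10 : ((Gamma0.degeneracyConj (N / 3) N 3 (div_three_mul_three_dvd' h9) γ : Gamma0 (N / 3)) :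
      SL(2, ℤ)) 1 0 = (γ : SL(2, ℤ)) 1 0 / 3 := by
    simp
  have hc11 : ((Gamma0.degeneracyConj (N / 3) N 3 (div_three_mul_three_dvd' h9) γ : Gamma0 (N / 3)) :
      SL(2, ℤ)) 1 1 = (γ : SL(2, ℤ)) 1 1 := rfl
  rw [hc00, hc10] at e00
  rw [hc11] at e11
  have e3 := three_mul_apply_one_zero_div N h9 γ
  interval_cases i
  · -- `g = DγD⁻¹`: `{∞, (g∞)/3} = {∞, γ∞} = 0`
    rw [pow_zero, one_mul, liftedSymbol_degeneracyConj]
    have hγ : (((γ : SL(2, ℤ)) : Matrix (Fin 2) (Fin 2) ℤ)).discr ≤ 0 := by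
      rw [discr_eq_sq_sub] at hdisc ⊢
      rw [e00, e11] at hdisc
      simpa using hdisc
    rw [symbolInt_eq_zero_of_discr_nonpos N hγ]
    exact zero_mem _
  · -- `g = T DγD⁻¹`: `{∞, (g∞)/3} = t_*{∞, γ∞} = −{∞, (tγ⁻¹t⁻¹)∞}`
    rw [liftedSymbol_gamma0T_pow_mul_degeneracyConj, pow_one]
    set γ' : Gamma0 N := shiftConjElt N h9 1 γ⁻¹ with hγ'
    have hval : shiftInt N h9 (symbolInt N γ) = -symbolInt N γ' := by
      rw [hγ', symbolInt_shiftConjElt_one, symbolInt_inv, map_neg, neg_neg]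
    rw [hval]
    refine Submodule.mem_sup_right (Submodule.neg_mem _ (Submodule.subset_span ⟨γ', ?_, rfl⟩))
    obtain ⟨s00, -, s10, s11⟩ := shiftConjElt_apply h9 1 γ⁻¹
    obtain ⟨i00, i10, i11⟩ := inv_apply N γ
    have key : 3 * (((γ' : Gamma0 N) : SL(2, ℤ)) 0 0 + ((γ' : Gamma0 N) : SL(2, ℤ)) 1 1) -
        ((γ' : Gamma0 N) : SL(2, ℤ)) 1 0 = 3 * ((γ : SL(2, ℤ)) 0 0 + (γ : SL(2, ℤ)) 1 0 / 3 + (γ : SL(2, ℤ)) 1 1) := by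
      rw [hγ', s00, s10, s11, i00, i10, i11]
      linear_combination -e3
    rw [key, abs_mul, show |(3 : ℤ)| = 3 by norm_num]
    rw [Nat.cast_one, one_mul] at e00
    rw [e00, e11] at htr
    linarith
  · -- `g = T² DγD⁻¹`: `{∞, (g∞)/3} = t_*²{∞, (T_N γ)∞} ≡ {∞, (T_N γ)∞} (mod Λ₁)`
    rw [liftedSymbol_gamma0T_pow_mul_degeneracyConj]
    set γ' : Gamma0 N := gamma0T N * γ with hγ'
    have hval : symbolInt N γ = symbolInt N γ' := by
      rw [hγ', symbolInt_mul, symbolInt_gamma0T, zero_add]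
    rw [hval]
    have e : (shiftInt N h9 ^ 2) (symbolInt N γ') =
        ((shiftInt N h9 ^ 2) (symbolInt N γ') - symbolInt N γ') + symbolInt N γ' := by abel
    rw [e]
    refine Submodule.add_mem_sup (shiftInt_pow_sub_mem_shiftSubOneLattice N h9 2 _)
      (Submodule.subset_span ⟨γ', ?_, rfl⟩)
    obtain ⟨t00, -, t10, t11⟩ := gamma0T_mul_apply N γ
    have key : 3 * (((γ' : Gamma0 N) : SL(2, ℤ)) 0 0 + ((γ' : Gamma0 N) : SL(2, ℤ)) 1 1) -
        ((γ' : Gamma0 N) : SL(2, ℤ)) 1 0 = 3 * ((γ : SL(2, ℤ)) 0 0 + 2 * ((γ : SL(2, ℤ)) 1 0 / 3) + (γ : SL(2, ℤ)) 1 1) := by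
      rw [hγ', t00, t10, t11]
      linear_combination -2 * e3
    rw [key, abs_mul, show |(3 : ℤ)| = 3 by norm_num]
    rw [Nat.cast_ofNat] at e00
    rw [e00, e11] at htr
    linarith

end FixedPoints

/-! ### Main theorem: `Λ_P ⊆ Λ₁ + ℤ·{fixed-point symbols}` -/

section Main

/-- **The Hilbert-90 defect of the triple cover `X₀(N) → X₀(N/3)` is spanned by fixed-point symbols**
(route TameQuarticManinParity, item E32a `PrymLatticeFixedPointSpan`, stmt-BirchSwinnertonDyer-23756, VERBATIM),
granted Knapp's presentation of `H₁(X₀(N/3), ℤ)` by periods (the named fact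
`periodFunctional_ker_le_ellipticParabolic_sup_commutator` of `PeriodHomologyGroupPresentation`, whose body is
the hypothesis `H`): for every `N` with `9 ∣ N`,
`Λ_P = ker Nm ⊆ (t − 1)Λ + ℤ{ {∞, γ∞} : γ = (a b; c d) ∈ Γ₀(N), |3(a + d) − c| ≤ 6 }` in `Λ = H₁(X₀(N), ℤ)`.
PROOF (no Jacobian, no uniformisation): `y ∈ Λ_P = ker π_*` (`ker_pushforwardInt_eq_prymLattice`), `y = {∞, γ₀∞}`,
and `π_*{∞, γ₀∞} = {∞, (Dγ₀D⁻¹)∞}_{N/3}` (`D = diag(3,1)`); so `Dγ₀D⁻¹ ∈ Γ₀(N/3)` has zero periods, hence (fact)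
lies in `Γ_ep(N/3)·[Γ₀(N/3), Γ₀(N/3)]`.  The lifted symbol `g ↦ {∞, (g∞)/3} mod Λ₁` is a homomorphism
`Γ₀(N/3) → Λ/Λ₁` (`liftedSymbolModHom`), so the set of `g` with `{∞, (g∞)/3} ∈ Λ₁ + F` is a subgroup containing
the commutators; it contains the parabolic and elliptic elements (`liftedSymbol_mem_of_isParabolic_or_isElliptic`);
hence it contains `Dγ₀D⁻¹`, whose lifted symbol is `{∞, γ₀∞} = y`.
[cite: Knapp1993, Prop. 11.22 (PDF p. 242)] [cite: Manin1972, §1.5 and Prop. 1.4]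
[cite: LangeRodriguez2022, §3.2.1 (PDF p. 55)] -/
theorem prymLattice_le_shiftSubOneLattice_sup_span_of_periodKernel
    (H : ∀ (M : ℕ) [NeZero M] (g : Gamma0 M), periodFunctional M g = 0 →
      g ∈ Subgroup.closure {x : Gamma0 M | ((x : SL(2, ℤ)) : Matrix (Fin 2) (Fin 2) ℤ).IsParabolic ∨
        ((x : SL(2, ℤ)) : Matrix (Fin 2) (Fin 2) ℤ).IsElliptic} ⊔ commutator (Gamma0 M))
    (N : ℕ) [NeZero N] (h9 : 3 ^ 2 ∣ N) :
    prymLattice N h9 ≤ shiftSubOneLattice N h9 ⊔ Submodule.span ℤ {x | ∃ γ : Gamma0 N,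
      |3 * ((γ : SL(2, ℤ)) 0 0 + (γ : SL(2, ℤ)) 1 1) - (γ : SL(2, ℤ)) 1 0| ≤ 6 ∧ symbolInt N γ = x} := by
  intro y hy
  haveI : NeZero (N / 3) := ⟨(Nat.div_pos (Nat.le_of_dvd (NeZero.pos N) (three_dvd h9)) three_pos).ne'⟩
  set W := shiftSubOneLattice N h9 ⊔ Submodule.span ℤ {x | ∃ γ : Gamma0 N,
      |3 * ((γ : SL(2, ℤ)) 0 0 + (γ : SL(2, ℤ)) 1 1) - (γ : SL(2, ℤ)) 1 0| ≤ 6 ∧ symbolInt N γ = x} with hW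
  have hΛ₁ : shiftSubOneLattice N h9 ≤ W := le_sup_left
  obtain ⟨γ₀, rfl⟩ := symbolInt_surjective N y
  -- `π_* y = 0`, i.e. `Dγ₀D⁻¹` has zero periods at level `N/3`
  have hker : symbolInt N γ₀ ∈ LinearMap.ker (pushforwardInt N (three_dvd h9)) := by
    rw [ker_pushforwardInt_eq_prymLattice N h9 (three_dvd h9)]
    exact hy
  have hM : periodFunctional (N / 3)
      (Gamma0.degeneracyConj (N / 3) N 3 (div_three_mul_three_dvd' h9) γ₀) = 0 := by
    have h := congrArg Subtype.val (LinearMap.mem_ker.mp hker)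
    rw [coe_pushforwardInt, coe_symbolInt,
      dualMap_degeneracyMap0_periodFunctional (div_three_mul_three_dvd' h9)] at h
    simpa using h
  have hmem := H (N / 3) _ hM
  -- the subgroup of `g ∈ Γ₀(N/3)` whose lifted symbol lies in `W`
  let S : Subgroup (Gamma0 (N / 3)) :=
    { carrier := {g | liftedSymbol N h9 g ∈ W}
      mul_mem' := fun {g g'} hg hg' ↦ by
        have h := liftedSymbol_mul_sub_sub_mem N h9 g g'
        have e : liftedSymbol N h9 (g * g') =
            (liftedSymbol N h9 (g * g') - liftedSymbol N h9 g - liftedSymbol N h9 g') +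
              liftedSymbol N h9 g + liftedSymbol N h9 g' := by abel
        change liftedSymbol N h9 (g * g') ∈ W
        rw [e]
        exact add_mem (add_mem (hΛ₁ h) hg) hg'
      one_mem' := by
        change liftedSymbol N h9 1 ∈ W
        rw [liftedSymbol_one]
        exact zero_mem _
      inv_mem' := fun {g} hg ↦ by
        have h := liftedSymbol_mul_sub_sub_mem N h9 g g⁻¹
        rw [mul_inv_cancel, liftedSymbol_one, zero_sub] at h
        have e : liftedSymbol N h9 g⁻¹ = -(-liftedSymbol N h9 g - liftedSymbol N h9 g⁻¹) - liftedSymbol N h9 g := by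
          abel
        change liftedSymbol N h9 g⁻¹ ∈ W
        rw [e]
        exact sub_mem (neg_mem (hΛ₁ h)) hg }
  have hle : Subgroup.closure {x : Gamma0 (N / 3) | ((x : SL(2, ℤ)) : Matrix (Fin 2) (Fin 2) ℤ).IsParabolic ∨
      ((x : SL(2, ℤ)) : Matrix (Fin 2) (Fin 2) ℤ).IsElliptic} ⊔ commutator (Gamma0 (N / 3)) ≤ S := by
    refine sup_le ((Subgroup.closure_le S).mpr fun g hg ↦ ?_) fun g hg ↦ ?_
    · exact liftedSymbol_mem_of_isParabolic_or_isElliptic N h9 g hg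
    · -- commutators die in the abelian group `Λ/Λ₁`
      have hk := Abelianization.commutator_subset_ker (liftedSymbolModHom N h9) hg
      rw [MonoidHom.mem_ker, liftedSymbolModHom_apply] at hk
      have hk' : (shiftSubOneLattice N h9).mkQ (liftedSymbol N h9 g) = 0 := congrArg Multiplicative.toAdd hk
      rw [Submodule.mkQ_apply, Submodule.Quotient.mk_eq_zero] at hk'
      exact hΛ₁ hk'
  have hS : liftedSymbol N h9 (Gamma0.degeneracyConj (N / 3) N 3 (div_three_mul_three_dvd' h9) γ₀) ∈ W :=
    hle hmem
  rwa [liftedSymbol_degeneracyConj] at hS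

/-- **E32a granted Knapp's presentation** (the named fact `periodFunctional_ker_le_ellipticParabolic_sup_commutator`
of `PeriodHomologyGroupPresentation`, Knapp 1993 Prop. 11.22 with (11.37), (11.42)): for `9 ∣ N`,
`Λ_P ⊆ (t − 1)Λ + ℤ{ {∞, γ∞} : |3(a + d) − c| ≤ 6 }`. [cite: Knapp1993, Prop. 11.22 (PDF p. 242)]
[cite: Manin1972, §1.5 and Prop. 1.4] -/
theorem prymLattice_le_shiftSubOneLattice_sup_span_fixedPoint
    (H : periodFunctional_ker_le_ellipticParabolic_sup_commutator) (N : ℕ) [NeZero N] (h9 : 3 ^ 2 ∣ N) :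
    prymLattice N h9 ≤ shiftSubOneLattice N h9 ⊔ Submodule.span ℤ {x | ∃ γ : Gamma0 N,
      |3 * ((γ : SL(2, ℤ)) 0 0 + (γ : SL(2, ℤ)) 1 1) - (γ : SL(2, ℤ)) 1 0| ≤ 6 ∧ symbolInt N γ = x} :=
  prymLattice_le_shiftSubOneLattice_sup_span_of_periodKernel (fun M _ g hg ↦ H M g hg) N h9

/-- **Item E32a `PrymLatticeFixedPointSpan` of route TameQuarticManinParity (stmt-BirchSwinnertonDyer-23756), its
statement VERBATIM** (with the route's spelling `(γ : SL(2,ℤ)).1 i j` of the entries), granted the named fact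
`periodFunctional_ker_le_ellipticParabolic_sup_commutator` (Knapp 1993, Prop. 11.22): for every `N` with
`9 ∣ N`, `prymLattice N h9 ≤ shiftSubOneLattice N h9 ⊔ span ℤ {symbolInt N γ : |3(γ₀₀ + γ₁₁) − γ₁₀| ≤ 6}`.
A Summit-side by-name proof of the item is the one-liner `fun N _ h9 ↦ prymLatticeFixedPointSpan_of_periodKernelFact H N h9`.
[cite: Knapp1993, Prop. 11.22 (PDF p. 242)] [cite: Manin1972, §1.5 and Prop. 1.4] -/
theorem prymLatticeFixedPointSpan_of_periodKernelFact
    (H : periodFunctional_ker_le_ellipticParabolic_sup_commutator) :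
    ∀ (N : ℕ) [NeZero N] (h9 : 3 ^ 2 ∣ N), prymLattice N h9 ≤ shiftSubOneLattice N h9 ⊔
      Submodule.span ℤ {x | ∃ γ : CongruenceSubgroup.Gamma0 N,
        |3 * ((γ : Matrix.SpecialLinearGroup (Fin 2) ℤ).1 0 0 + (γ : Matrix.SpecialLinearGroup (Fin 2) ℤ).1 1 1) -
          (γ : Matrix.SpecialLinearGroup (Fin 2) ℤ).1 1 0| ≤ 6 ∧ symbolInt N γ = x} :=
  fun N _ h9 ↦ prymLattice_le_shiftSubOneLattice_sup_span_fixedPoint H N h9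

end Main

end Literature.NumberTheory.ModularSymbols
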